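import Summits.AnomalousDissipation.AnomalousDissipation.Theorems.MarginalStabilityChainStrainedLayerLawStubMomentPairKernelGreen

/-!
# Stub `stub_momentPairKernel` (crux stmt-AnomalousDissipation-3007, line `strain-work-sum-rule`):
# `strainMoment L u v = −½ pairForm L (vorticity u v)`

Stub file (`--supports stmt-AnomalousDissipation-3007`): proves the REGISTERED stub `stub_momentPairKernel` of the
lead's skeleton (`Cruxes/StrainedLayerLaw/Lines/strain_work_sum_rule.lean`, hypothesis `h2b` of
`StrainedLayerLaw_of_sumRuleStubs` in `…StrainedLayerLawSumRuleLine`) BY NAME with its signature verbatim: for one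
`C²`, divergence-free, `L`-periodic slice `(u, v)` with the shear far field `u → ±½`, `v → 0` and shear tails
`SliceTails C k u v`, the first `y`-moment of `ωu` over a period strip is the explicit nonnegative quadratic form
of the vorticity, `∫∫ yωu = −½ K_L[ω]`.

Contents: the integrands on `cell × cell` — `pairI = ω(z)ω(z′)K_L^ε(z − z′)`, `momT = ω(z)ω(z′) y K₁^ε(z − z′)/(2L)`,
`momS` (with `y′`): `pairI = momT − momS`, the swap `momS(z′, z) = −momT(z, z′)`, continuity, product majorants
`a(y) b(y′)` with the layer weight `(1 + |y|)² e^{−k|y|}` (for `pairI` UNIFORMLY in `ε ≥ 0`), `y ω u_ε = −∫∫ momT`;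
then the assembly (tools A–C = `…StubMomentPairKernelKernels/Strip/Green`): at level `ε ∈ (0, 1]`,
`∫∫ y ω u_ε = −∫∫∫∫ momT = −½ K_L^ε[ω]` by Fubini on `cell × cell` (continuous integrands with product majorants),
the swap `(z, z′) ↦ (z′, z)` (`integral_prod_swap`) and the oddness of `K₁^ε` (`integral_moment_uReg`); then
`ε → 0⁺`: `∫∫ y ω u_ε → strainMoment` (`u_ε → u`, `|u_ε| ≤ C + ½`, dominated convergence twice) and
`K_L^ε[ω] → K_L[ω]` (dominated convergence four times under the UNIFORM bound `|K_L^ε(δ)| ≤ |δy|/(2L) + 1/(2π)` and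
pointwise convergence at every point), and limits along `𝓝[>] 0` are unique. Normalisation checked on the Burgers
layer (`strainMoment = −½ pairForm = −L√ν/(2√π)`, worker memo). All `[folklore]`.
-/

-- `Summit.<Summit>.<Problem>` is the tree's mandated summit-side namespace (CONVENTIONS §2); for this
-- single-conjunct summit the two coincide, so the duplicate is deliberate.
set_option linter.dupNamespace false

noncomputable section

open scoped Topology
open Filter Set Function MeasureTheory Real

namespace Summit.AnomalousDissipation.AnomalousDissipation.Theorems.StrainedLayerLaw.StrainWorkSumRule

open Summit.AnomalousDissipation.AnomalousDissipation.Theorems.MarginalStabilityChainStretchedVortexRows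
open Literature.Analysis.FluidPDE Literature.Analysis.FluidPDE.StretchedLayer

/-! ### The regularised pair form and the symmetrisation at level `ε` -/

/-- The regularised circulation-concentration functional `K_L^ε[ω]` (iterated, as `pairForm`). [folklore] -/
def pairFormReg (L ε : ℝ) (ω : ℝ → ℝ → ℝ) : ℝ :=
  ∫ x in Ioc 0 L, ∫ y, ∫ x' in Ioc 0 L, ∫ y', ω x y * ω x' y' * pairKernelReg L ε (x - x') (y - y')

/-- The pair integrand `ω(z) ω(z′) K_L^ε(z − z′)`. [folklore] -/
def pairI (L ε : ℝ) (ω : ℝ → ℝ → ℝ) (x y x' y' : ℝ) : ℝ :=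
  ω x y * ω x' y' * pairKernelReg L ε (x - x') (y - y')

/-- The moment integrand `ω(z) ω(z′) y K₁^ε(z − z′)/(2L)`. [folklore] -/
def momT (L ε : ℝ) (ω : ℝ → ℝ → ℝ) (x y x' y' : ℝ) : ℝ :=
  ω x y * ω x' y' * (y * kerU L ε (x - x') (y - y') / (2 * L))

/-- The swapped moment integrand `ω(z) ω(z′) y′ K₁^ε(z − z′)/(2L)`. [folklore] -/
def momS (L ε : ℝ) (ω : ℝ → ℝ → ℝ) (x y x' y' : ℝ) : ℝ :=
  ω x y * ω x' y' * (y' * kerU L ε (x - x') (y - y') / (2 * L))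

section Integrands

variable {L C k ε : ℝ} {u v : ℝ → ℝ → ℝ} {ω : ℝ → ℝ → ℝ}

/-- `pairI = momT − momS` (`ε > 0`). [folklore] -/
theorem pairI_eq (hε : 0 < ε) (L : ℝ) (ω : ℝ → ℝ → ℝ) (x y x' y' : ℝ) :
    pairI L ε ω x y x' y' = momT L ε ω x y x' y' - momS L ε ω x y x' y' := by
  simp only [pairI, momT, momS]
  rw [pairKernelReg_eq hε]
  ring

/-- The swap turns `momS` into `−momT` (oddness of `K₁^ε`). [folklore] -/
theorem momS_swap (L ε : ℝ) (ω : ℝ → ℝ → ℝ) (x y x' y' : ℝ) :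
    momS L ε ω x' y' x y = -momT L ε ω x y x' y' := by
  simp only [momS, momT]
  rw [show x' - x = -(x - x') by ring, show y' - y = -(y - y') by ring, kerU_neg_neg]
  ring

/-- `momT` is continuous (`fun_prop` with the kernel's continuity in context: unfolding the kernel inside the
unifier is prohibitively slow). [folklore] -/
theorem continuous_momT (hε : 0 < ε) (L : ℝ) (hω : Continuous fun p : ℝ × ℝ => ω p.1 p.2) :
    Continuous fun p : (ℝ × ℝ) × (ℝ × ℝ) => momT L ε ω p.1.1 p.1.2 p.2.1 p.2.2 := by
  have hc := continuous_kerU hε L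
  unfold momT
  fun_prop

/-- `momS` is continuous. [folklore] -/
theorem continuous_momS (hε : 0 < ε) (L : ℝ) (hω : Continuous fun p : ℝ × ℝ => ω p.1 p.2) :
    Continuous fun p : (ℝ × ℝ) × (ℝ × ℝ) => momS L ε ω p.1.1 p.1.2 p.2.1 p.2.2 := by
  have hc := continuous_kerU hε L
  unfold momS
  fun_prop

/-- `pairI` is continuous (`ε > 0`, `L ≠ 0`). [folklore] -/
theorem continuous_pairI (hε : 0 < ε) (hL : L ≠ 0) (hω : Continuous fun p : ℝ × ℝ => ω p.1 p.2) :
    Continuous fun p : (ℝ × ℝ) × (ℝ × ℝ) => pairI L ε ω p.1.1 p.1.2 p.2.1 p.2.2 := by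
  have hc := continuous_pairKernelReg hε hL
  unfold pairI
  fun_prop

/-- The layer weight dominates `(1 + |y|) e^{−k|y|}`. [folklore] -/
theorem one_add_abs_mul_exp_le (k y : ℝ) :
    (1 + |y|) * Real.exp (-k * |y|) ≤ (1 + |y|) ^ 2 * Real.exp (-k * |y|) := by
  have h1 : (1 + |y|) ≤ (1 + |y|) ^ 2 := by nlinarith [abs_nonneg y]
  exact mul_le_mul_of_nonneg_right h1 (Real.exp_pos _).le

/-- **The uniform product majorant of the pair integrand**: for `ε ≥ 0`,
`|pairI| ≤ (K₀ C w(y)) (C w(y′))`, `K₀ = 1/(2L) + 1/(2π)`, `w(y) = (1+|y|)² e^{−k|y|}`. [folklore] -/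
theorem abs_pairI_le (hL : 0 < L) (hT : SliceTails C k u v) (hε : 0 ≤ ε) (x y x' y' : ℝ) :
    |pairI L ε (vorticity u v) x y x' y'| ≤
      (1 / (2 * L) + 1 / (2 * π)) * C * ((1 + |y|) ^ 2 * Real.exp (-k * |y|)) *
        (C * ((1 + |y'|) ^ 2 * Real.exp (-k * |y'|))) := by
  have hC := (tails_C_nonneg hT)
  have h1 := (tails_abs_vorticity_le hT) x y
  have h2 := (tails_abs_vorticity_le hT) x' y'
  have h3 := abs_pairKernelReg_le hL hε (x - x') (y - y')
  have hK : |y - y'| / (2 * L) + 1 / (2 * π) ≤ (1 / (2 * L) + 1 / (2 * π)) * ((1 + |y|) * (1 + |y'|)) := by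
    have hyy : |y - y'| ≤ (1 + |y|) * (1 + |y'|) := by
      have := abs_sub y y'
      nlinarith [abs_nonneg y, abs_nonneg y']
    have hone : (1:ℝ) ≤ (1 + |y|) * (1 + |y'|) := by nlinarith [abs_nonneg y, abs_nonneg y']
    have hL2 : (0:ℝ) < 1 / (2 * L) := by positivity
    have hπ2 : (0:ℝ) < 1 / (2 * π) := by positivity
    calc |y - y'| / (2 * L) + 1 / (2 * π) = 1 / (2 * L) * |y - y'| + 1 / (2 * π) * 1 := by ring
      _ ≤ 1 / (2 * L) * ((1 + |y|) * (1 + |y'|)) + 1 / (2 * π) * ((1 + |y|) * (1 + |y'|)) :=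
          add_le_add (mul_le_mul_of_nonneg_left hyy hL2.le) (mul_le_mul_of_nonneg_left hone hπ2.le)
      _ = _ := by ring
  have hw1 := one_add_abs_mul_exp_le k y
  have hw2 := one_add_abs_mul_exp_le k y'
  unfold pairI
  rw [abs_mul, abs_mul]
  calc |vorticity u v x y| * |vorticity u v x' y'| * |pairKernelReg L ε (x - x') (y - y')|
      ≤ (C * Real.exp (-k * |y|)) * (C * Real.exp (-k * |y'|)) *
          ((1 / (2 * L) + 1 / (2 * π)) * ((1 + |y|) * (1 + |y'|))) :=
        mul_le_mul (mul_le_mul h1 h2 (abs_nonneg _) (by positivity)) (h3.trans hK) (abs_nonneg _)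
          (by positivity)
    _ = (1 / (2 * L) + 1 / (2 * π)) * C * ((1 + |y|) * Real.exp (-k * |y|)) *
          (C * ((1 + |y'|) * Real.exp (-k * |y'|))) := by ring
    _ ≤ _ := by
        have hA : 0 ≤ (1 / (2 * L) + 1 / (2 * π)) * C := by positivity
        exact mul_le_mul (mul_le_mul_of_nonneg_left hw1 hA) (mul_le_mul_of_nonneg_left hw2 hC)
          (by positivity) (by positivity)

/-- `|y K₁^ε/(2L)| ≤ ((2 + 2/ε)/(2L)) |y|`. [folklore] -/
theorem abs_mul_kerU_div_le (hL : 0 < L) (hε : 0 < ε) (y δx δy : ℝ) :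
    |y * kerU L ε δx δy / (2 * L)| ≤ (2 + 2 / ε) / (2 * L) * |y| := by
  rw [abs_div, abs_mul, abs_of_pos (by positivity : (0:ℝ) < 2 * L), div_le_iff₀ (by positivity : (0:ℝ) < 2 * L)]
  calc |y| * |kerU L ε δx δy| ≤ |y| * (2 + 2 / ε) := mul_le_mul_of_nonneg_left (abs_kerU_le hε L _ _) (abs_nonneg _)
    _ = (2 + 2 / ε) / (2 * L) * |y| * (2 * L) := by field_simp

/-- Product majorant of `momT` at fixed `ε`. [folklore] -/
theorem abs_momT_le (hL : 0 < L) (hT : SliceTails C k u v) (hε : 0 < ε) (x y x' y' : ℝ) :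
    |momT L ε (vorticity u v) x y x' y'| ≤
      ((2 + 2 / ε) / (2 * L) * C * ((1 + |y|) ^ 2 * Real.exp (-k * |y|))) *
        (C * ((1 + |y'|) ^ 2 * Real.exp (-k * |y'|))) := by
  have hC := (tails_C_nonneg hT)
  have h1 := (tails_abs_vorticity_le hT) x y
  have h2 := (tails_abs_vorticity_le hT) x' y'
  have h3 := abs_mul_kerU_div_le hL hε y (x - x') (y - y')
  have hw1 := abs_mul_exp_le_one_add_abs_sq_mul_exp k y
  have hw2 := exp_le_one_add_abs_sq_mul_exp k y'
  have hK : 0 ≤ (2 + 2 / ε) / (2 * L) := by positivity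
  unfold momT
  rw [abs_mul, abs_mul]
  calc |vorticity u v x y| * |vorticity u v x' y'| * |y * kerU L ε (x - x') (y - y') / (2 * L)|
      ≤ (C * Real.exp (-k * |y|)) * (C * Real.exp (-k * |y'|)) * ((2 + 2 / ε) / (2 * L) * |y|) :=
        mul_le_mul (mul_le_mul h1 h2 (abs_nonneg _) (by positivity)) h3 (abs_nonneg _) (by positivity)
    _ = (2 + 2 / ε) / (2 * L) * C * (|y| * Real.exp (-k * |y|)) * (C * Real.exp (-k * |y'|)) := by ring
    _ ≤ _ := mul_le_mul (mul_le_mul_of_nonneg_left hw1 (by positivity)) (mul_le_mul_of_nonneg_left hw2 hC)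
          (by positivity) (by positivity)

/-- Product majorant of `momS` at fixed `ε`. [folklore] -/
theorem abs_momS_le (hL : 0 < L) (hT : SliceTails C k u v) (hε : 0 < ε) (x y x' y' : ℝ) :
    |momS L ε (vorticity u v) x y x' y'| ≤
      (C * ((1 + |y|) ^ 2 * Real.exp (-k * |y|))) *
        ((2 + 2 / ε) / (2 * L) * C * ((1 + |y'|) ^ 2 * Real.exp (-k * |y'|))) := by
  have hC := (tails_C_nonneg hT)
  have h1 := (tails_abs_vorticity_le hT) x y
  have h2 := (tails_abs_vorticity_le hT) x' y'
  have h3 := abs_mul_kerU_div_le hL hε y' (x - x') (y - y')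
  have hw1 := exp_le_one_add_abs_sq_mul_exp k y
  have hw2 := abs_mul_exp_le_one_add_abs_sq_mul_exp k y'
  have hK : 0 ≤ (2 + 2 / ε) / (2 * L) := by positivity
  unfold momS
  rw [abs_mul, abs_mul]
  calc |vorticity u v x y| * |vorticity u v x' y'| * |y' * kerU L ε (x - x') (y - y') / (2 * L)|
      ≤ (C * Real.exp (-k * |y|)) * (C * Real.exp (-k * |y'|)) * ((2 + 2 / ε) / (2 * L) * |y'|) :=
        mul_le_mul (mul_le_mul h1 h2 (abs_nonneg _) (by positivity)) h3 (abs_nonneg _) (by positivity)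
    _ = C * Real.exp (-k * |y|) * ((2 + 2 / ε) / (2 * L) * C * (|y'| * Real.exp (-k * |y'|))) := by ring
    _ ≤ _ := mul_le_mul (mul_le_mul_of_nonneg_left hw1 hC) (mul_le_mul_of_nonneg_left hw2 (by positivity))
          (by positivity) (by positivity)

/-- Constants move through two iterated integrals (no integrability needed). [folklore] -/
theorem const_mul_integral2 (c L : ℝ) (F : ℝ → ℝ → ℝ) :
    c * ∫ x' in Ioc 0 L, ∫ y', F x' y' = ∫ x' in Ioc 0 L, ∫ y', c * F x' y' := by
  rw [← integral_const_mul]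
  refine integral_congr_ae (Eventually.of_forall fun x' => ?_)
  exact (integral_const_mul c _).symm

/-- `y ω u_ε = −∫∫ momT` pointwise (the representation `u_ε = −(2L)⁻¹∫∫K₁^ε ω`). [folklore] -/
theorem moment_uReg_eq (hL : 0 < L) (hk : 0 < k) (hu : ContDiff ℝ 2 (fun q : ℝ × ℝ => u q.1 q.2))
    (hv : ContDiff ℝ 2 (fun q : ℝ × ℝ => v q.1 q.2)) (hdiv : ∀ x y, dX u x y + dY v x y = 0)
    (hperu : ∀ x y, u (x + L) y = u x y) (hperv : ∀ x y, v (x + L) y = v x y)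
    (htop : ∀ x, Tendsto (fun y => u x y) atTop (𝓝 (1 / 2)))
    (hbot : ∀ x, Tendsto (fun y => u x y) atBot (𝓝 (-(1 / 2)))) (hT : SliceTails C k u v) (hε : 0 < ε)
    (hε1 : ε ≤ 1) (x y : ℝ) :
    y * vorticity u v x y * uReg L ε u x y = -∫ x' in Ioc 0 L, ∫ y', momT L ε (vorticity u v) x y x' y' := by
  rw [uReg_eq hL hk hu hv hdiv hperu hperv htop hbot hT hε hε1 x y, ← mul_assoc, const_mul_integral2, ← MeasureTheory.integral_neg]
  refine integral_congr_ae (Eventually.of_forall fun x' => ?_)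
  show (∫ y', y * vorticity u v x y * -(1 / (2 * L)) * (kerU L ε (x - x') (y - y') * vorticity u v x' y')) =
    -∫ y', momT L ε (vorticity u v) x y x' y'
  rw [← MeasureTheory.integral_neg]
  refine integral_congr_ae (Eventually.of_forall fun y' => ?_)
  show y * vorticity u v x y * -(1 / (2 * L)) * (kerU L ε (x - x') (y - y') * vorticity u v x' y') =
    -momT L ε (vorticity u v) x y x' y'
  simp only [momT]; ring

end Integrands

section Assembly

variable {L C k ε : ℝ} {u v : ℝ → ℝ → ℝ}

/-- **Symmetrisation at level `ε`**: `∫∫ y ω u_ε = −½ K_L^ε[ω]` for `0 < ε ≤ 1` (Fubini on `cell × cell` for the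
continuous dominated integrands, the swap `(z, z′) ↦ (z′, z)` and the oddness of `K₁^ε`). [folklore] -/
theorem integral_moment_uReg (hL : 0 < L) (hk : 0 < k) (hu : ContDiff ℝ 2 (fun q : ℝ × ℝ => u q.1 q.2))
    (hv : ContDiff ℝ 2 (fun q : ℝ × ℝ => v q.1 q.2)) (hdiv : ∀ x y, dX u x y + dY v x y = 0)
    (hperu : ∀ x y, u (x + L) y = u x y) (hperv : ∀ x y, v (x + L) y = v x y)
    (htop : ∀ x, Tendsto (fun y => u x y) atTop (𝓝 (1 / 2)))
    (hbot : ∀ x, Tendsto (fun y => u x y) atBot (𝓝 (-(1 / 2)))) (hT : SliceTails C k u v) (hε : 0 < ε)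
    (hε1 : ε ≤ 1) :
    ∫ x in Ioc 0 L, ∫ y, y * vorticity u v x y * uReg L ε u x y = -(1 / 2) * pairFormReg L ε (vorticity u v) := by
  have iw : Integrable fun y => (1 + |y|) ^ 2 * Real.exp (-k * |y|) := integrable_one_add_abs_sq_mul_exp hk
  have hωc := (continuous_vorticity hu hv)
  -- Fubini: iterated = product, for the three integrands
  obtain ⟨iT, eT⟩ := integral4_eq_integral_prod (continuous_momT hε L hωc)
    (iw.const_mul ((2 + 2 / ε) / (2 * L) * C)) (iw.const_mul C) (fun x y x' y' => abs_momT_le hL hT hε x y x' y') L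
  obtain ⟨iS, -⟩ := integral4_eq_integral_prod (continuous_momS hε L hωc)
    (iw.const_mul C) (iw.const_mul ((2 + 2 / ε) / (2 * L) * C)) (fun x y x' y' => abs_momS_le hL hT hε x y x' y') L
  obtain ⟨iF, eF⟩ := integral4_eq_integral_prod (continuous_pairI hε hL.ne' hωc)
    (iw.const_mul ((1 / (2 * L) + 1 / (2 * π)) * C)) (iw.const_mul C)
    (fun x y x' y' => abs_pairI_le hL hT hε.le x y x' y') L
  set μ : Measure (ℝ × ℝ) := (volume.restrict (Ioc 0 L)).prod volume
  -- LHS = −∫ momT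
  have hLHS : (∫ x in Ioc 0 L, ∫ y, y * vorticity u v x y * uReg L ε u x y) =
      -∫ x in Ioc 0 L, ∫ y, ∫ x' in Ioc 0 L, ∫ y', momT L ε (vorticity u v) x y x' y' := by
    rw [← MeasureTheory.integral_neg]
    refine integral_congr_ae (Eventually.of_forall fun x => ?_)
    show (∫ y, y * vorticity u v x y * uReg L ε u x y) =
      -∫ y, ∫ x' in Ioc 0 L, ∫ y', momT L ε (vorticity u v) x y x' y'
    rw [← MeasureTheory.integral_neg]
    exact integral_congr_ae (Eventually.of_forall fun y => moment_uReg_eq hL hk hu hv hdiv hperu hperv htop hbot hT hε hε1 x y)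
  -- ∫ momS = −∫ momT by the swap
  have hswap : (∫ p, momS L ε (vorticity u v) p.1.1 p.1.2 p.2.1 p.2.2 ∂(μ.prod μ)) =
      -∫ p, momT L ε (vorticity u v) p.1.1 p.1.2 p.2.1 p.2.2 ∂(μ.prod μ) := by
    rw [← integral_prod_swap, ← MeasureTheory.integral_neg]
    exact integral_congr_ae (Eventually.of_forall fun p => momS_swap L ε _ p.1.1 p.1.2 p.2.1 p.2.2)
  -- ∫ pairI = ∫ momT − ∫ momS
  have hFTS : (∫ p, pairI L ε (vorticity u v) p.1.1 p.1.2 p.2.1 p.2.2 ∂(μ.prod μ)) =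
      (∫ p, momT L ε (vorticity u v) p.1.1 p.1.2 p.2.1 p.2.2 ∂(μ.prod μ)) -
        ∫ p, momS L ε (vorticity u v) p.1.1 p.1.2 p.2.1 p.2.2 ∂(μ.prod μ) := by
    rw [← integral_sub iT iS]
    exact integral_congr_ae (Eventually.of_forall fun p => pairI_eq hε L _ _ _ _ _)
  have hPF : pairFormReg L ε (vorticity u v) = ∫ p, pairI L ε (vorticity u v) p.1.1 p.1.2 p.2.1 p.2.2 ∂(μ.prod μ) :=
    eF
  rw [hLHS, eT, hPF, hFTS, hswap]
  ring

/-! ### The limits `ε → 0⁺` and the stub -/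

/-- **`∫∫ y ω u_ε → strainMoment`** as `ε → 0⁺` (two dominated convergences; `u_ε → u`, `|u_ε| ≤ C + ½`).
[folklore] -/
theorem tendsto_moment_uReg (hL : 0 < L) (hk : 0 < k) (hu : ContDiff ℝ 2 (fun q : ℝ × ℝ => u q.1 q.2))
    (hv : ContDiff ℝ 2 (fun q : ℝ × ℝ => v q.1 q.2)) (hT : SliceTails C k u v) :
    Tendsto (fun ε => ∫ x in Ioc 0 L, ∫ y, y * vorticity u v x y * uReg L ε u x y) (𝓝[>] 0)
      (𝓝 (strainMoment L u v)) := by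
  have hC := (tails_C_nonneg hT)
  refine tendsto_integral2_of_dominated (G := fun ε x y => y * vorticity u v x y * uReg L ε u x y)
    (G0 := fun x y => y * vorticity u v x y * u x y) (fun ε hε hε1 => ?_)
    (a := fun y => C * (C + 1 / 2) * ((1 + |y|) ^ 2 * Real.exp (-k * |y|)))
    ((integrable_one_add_abs_sq_mul_exp hk).const_mul _) (fun ε hε hε1 x y => ?_) (fun x y => ?_) L
  · exact ((continuous_snd.mul (continuous_vorticity hu hv)).mul (continuous_uReg hL hε hε1 hu.continuous (tails_abs_u_le hT hk)))
  · have h1 := (tails_abs_vorticity_le hT) x y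
    have h2 := abs_uReg_le hL hε hε1 hu.continuous (tails_abs_u_le hT hk) x y
    have hw := abs_mul_exp_le_one_add_abs_sq_mul_exp k y
    rw [abs_mul, abs_mul]
    calc |y| * |vorticity u v x y| * |uReg L ε u x y| ≤ |y| * (C * Real.exp (-k * |y|)) * (C + 1 / 2) :=
          mul_le_mul (mul_le_mul_of_nonneg_left h1 (abs_nonneg _)) h2 (abs_nonneg _) (by positivity)
      _ = C * (C + 1 / 2) * (|y| * Real.exp (-k * |y|)) := by ring
      _ ≤ _ := mul_le_mul_of_nonneg_left hw (by positivity)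
  · exact (tendsto_uReg hL hu.continuous (tails_abs_u_le hT hk) x y).const_mul _

/-- **`K_L^ε[ω] → K_L[ω]`** as `ε → 0⁺` (four dominated convergences under the uniform pair-kernel bound;
pointwise convergence at every point). [folklore] -/
theorem tendsto_pairFormReg (hL : 0 < L) (hk : 0 < k) (hu : ContDiff ℝ 2 (fun q : ℝ × ℝ => u q.1 q.2))
    (hv : ContDiff ℝ 2 (fun q : ℝ × ℝ => v q.1 q.2)) (hT : SliceTails C k u v) :
    Tendsto (fun ε => pairFormReg L ε (vorticity u v)) (𝓝[>] 0) (𝓝 (pairForm L (vorticity u v))) := by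
  have iw : Integrable fun y => (1 + |y|) ^ 2 * Real.exp (-k * |y|) := integrable_one_add_abs_sq_mul_exp hk
  refine tendsto_integral4_of_dominated hL.le
    (H := fun ε x y x' y' => vorticity u v x y * vorticity u v x' y' * pairKernelReg L ε (x - x') (y - y'))
    (H0 := fun x y x' y' => vorticity u v x y * vorticity u v x' y' * pairKernel L (x - x') (y - y'))
    (fun ε hε _ => ?_) (iw.const_mul ((1 / (2 * L) + 1 / (2 * π)) * C)) (iw.const_mul C)
    (fun ε hε _ x y x' y' => ?_) (fun x y x' y' => ?_)
  · exact continuous_pairI hε hL.ne' (continuous_vorticity hu hv)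
  · exact abs_pairI_le hL hT hε.le x y x' y'
  · exact tendsto_const_nhds.mul (tendsto_pairKernelReg L (x - x') (y - y'))

/-- **The stub on one slice**: `strainMoment L u v = −½ pairForm L (vorticity u v)` (uniqueness of limits along
`ε → 0⁺` of the level-`ε` identity). [folklore] -/
theorem strainMoment_eq_of_hyps (hL : 0 < L) (hk : 0 < k) (hu : ContDiff ℝ 2 (fun q : ℝ × ℝ => u q.1 q.2))
    (hv : ContDiff ℝ 2 (fun q : ℝ × ℝ => v q.1 q.2)) (hdiv : ∀ x y, dX u x y + dY v x y = 0)
    (hperu : ∀ x y, u (x + L) y = u x y) (hperv : ∀ x y, v (x + L) y = v x y)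
    (htop : ∀ x, Tendsto (fun y => u x y) atTop (𝓝 (1 / 2)))
    (hbot : ∀ x, Tendsto (fun y => u x y) atBot (𝓝 (-(1 / 2)))) (hT : SliceTails C k u v) :
    strainMoment L u v = -(1 / 2) * pairForm L (vorticity u v) := by
  have h1 := tendsto_moment_uReg hL hk hu hv hT
  have h2 : Tendsto (fun ε => -(1 / 2) * pairFormReg L ε (vorticity u v)) (𝓝[>] 0)
      (𝓝 (-(1 / 2) * pairForm L (vorticity u v))) := (tendsto_pairFormReg hL hk hu hv hT).const_mul _
  have hev : ∀ᶠ ε in 𝓝[>] (0:ℝ), 0 < ε ∧ ε ≤ 1 := by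
    filter_upwards [Ioc_mem_nhdsGT one_pos] with ε hε using hε
  refine tendsto_nhds_unique_of_eventuallyEq h1 h2 ?_
  filter_upwards [hev] with ε hε
  exact integral_moment_uReg hL hk hu hv hdiv hperu hperv htop hbot hT hε.1 hε.2

end Assembly

/-- **Stub `stub_momentPairKernel` of the line `strain-work-sum-rule`** (registered on
stmt-AnomalousDissipation-3007): for one `C²`, divergence-free, `L`-periodic slice `(u, v)` with the shear far
field `u → ±½`, `v → 0` and shear tails, the first `y`-moment of `ωu` is the explicit nonnegative quadratic form
`−½ K_L[ω]` of the vorticity: `strainMoment L u v = −½ pairForm L (vorticity u v)`. Proof: Green's identity at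
level `ε` for the regularised cylinder kernels (four integrations by parts on the period strip; the fluxes
`K₁^ε u → −½` at `y′ → ±∞` cancel), the approximate identity `ΔΦ_ε^L` of the 3009 tools (`u_ε → u`), Fubini and
the oddness of `K₁^ε` on `cell × cell`, and dominated convergence `ε → 0⁺` under the uniform pair-kernel bound
`|K_L^ε(δ)| ≤ |δy|/(2L) + 1/(2π)`. [folklore] -/
theorem stub_momentPairKernel : ∀ (L C k : ℝ), 0 < L → 0 < k → ∀ (u v : ℝ → ℝ → ℝ),
    ContDiff ℝ 2 (fun q : ℝ × ℝ => u q.1 q.2) → ContDiff ℝ 2 (fun q : ℝ × ℝ => v q.1 q.2) →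
    (∀ x y, dX u x y + dY v x y = 0) →
    (∀ x y, u (x + L) y = u x y) → (∀ x y, v (x + L) y = v x y) →
    (∀ x, Tendsto (fun y => u x y) atTop (𝓝 (1 / 2))) →
    (∀ x, Tendsto (fun y => u x y) atBot (𝓝 (-(1 / 2)))) →
    (∀ x, Tendsto (fun y => v x y) atTop (𝓝 0)) →
    (∀ x, Tendsto (fun y => v x y) atBot (𝓝 0)) →
    SliceTails C k u v →
      strainMoment L u v = -(1 / 2) * pairForm L (vorticity u v) :=
  fun _ _ _ hL hk _ _ hu hv hdiv hperu hperv htop hbot _ _ hT =>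
    strainMoment_eq_of_hyps hL hk hu hv hdiv hperu hperv htop hbot hT

end Summit.AnomalousDissipation.AnomalousDissipation.Theorems.StrainedLayerLaw.StrainWorkSumRule

end
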